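import Literature.MathematicalPhysics.KineticTheory.LangevinChainLyapunovDrift
import Literature.MathematicalPhysics.KineticTheory.SiteChainLangevinKernel
import Literature.MathematicalPhysics.KineticTheory.ReyBelletThomas2002ExpBound
import HarnessLib

/-!
# Hairer–Mattingly 2009, Prop. 5.1, for site-inhomogeneous Langevin chains: the drift inequality and
# an invariant measure from a pointwise Lyapunov function

Topic `Literature/MathematicalPhysics/KineticTheory`, grouping namespace `…KineticTheory.HeatConduction`.
Twin, for the site-dependent chains `SiteChain` (`CellChain.lean`) and Markov semigroups in the generic
interface `MarkovSemigroupFor ((P : SiteChain).generator N T_L T_R)` (`ReyBelletThomas2002.lean`), of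
`LangevinChainLyapunovDrift.lean` (the same statements for the homogeneous `OscillatorChain` and the
interface `LangevinChainSemigroup`). Hairer–Mattingly, Comm. Pure Appl. Math. **62** (2009), Prop. 5.1:
"Suppose there exists a smooth function `𝒱 : ℝⁿ → ℝ₊` with the property that the level sets
`{x : L𝒱(x) ≥ C}` are compact for every `C`, then the SDE has an invariant probability measure `μ`."
with its proof ("`-∫₀ᵗ E L𝒱(x_s) ds ≤ 𝒱(x₀)` … the sequence of measures `μ_t` … is tight … Kryloff–
Bogoliouboff"). As there, `𝒱` is assumed PROPER (compact sublevel sets) and the localisation of the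
printed proof is a spatial truncation `R φ(𝒱/R)` (`linCutoff`, `smoothCutoff`).

* under `hP : P.UniformlyConfining`: `continuous_generator`, `hasCompactSupport_generator`,
  `exists_bound_generator` for `f ∈ C²(_c)` (the generic `MarkovSemigroupFor` kernel API —
  `integrable_kernel_of_norm_le`, `norm_act_le`, `stronglyMeasurable_uncurry_act` — is imported);
* `MarkovSemigroupFor.siteChain_lintegral_truncLyapunov_add_le` — **the truncated drift inequality**:
  `L𝒱 ≤ C - W` pointwise (`W ≥ 0` continuous, `C ≥ 0`) gives, for every `R > 0` and every
  `S : MarkovSemigroupFor (P.generator …)` with Dynkin on `C²_c`,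
  `∫ Rφ(𝒱/R) dP_t(z,·) + ∫₀ᵗ ∫ χ(𝒱/R) W dP_s(z,·) ds ≤ 𝒱(z) + C t`.
  The untruncated inequality, the Cesàro bound and Prop. 5.1 are in `SiteChainLyapunovInvariant.lean`.

## References

* M. Hairer, J. C. Mattingly, Comm. Pure Appl. Math. **62** (2009) 999–1032, Prop. 5.1 and its proof.
* R. Khasminskii, *Stochastic Stability of Differential Equations* (2nd ed., 2012), Thm 3.7.
* G. Da Prato, J. Zabczyk, *Ergodicity for infinite-dimensional systems* (1996), Cor. 3.1.2.

## Design choices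

* Proofs are those of `LangevinChainLyapunovDrift.lean` verbatim, with `P.drift`/`bathVecL/R` replaced by
  `P.langevinDrift`/`noiseVecL/R` and the `C¹`-potential hypotheses bundled in `UniformlyConfining`.
* NOT here: any particular Lyapunov function (none is known for the mixed-degree cell chains; this file is
  the reduction "pointwise `L𝒱 ≤ C - W` ⇒ Cesàro bound / invariant measure" they would plug into).
-/

noncomputable section

open MeasureTheory ProbabilityTheory Filter Topology Set Metric Function
open scoped NNReal ENNReal Topology BoundedContinuousFunction

namespace Literature.MathematicalPhysics.KineticTheory.HeatConduction

open Literature.MathematicalPhysics.KineticTheory Literature.Probability.Process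

variable {N : ℕ}

namespace SiteChain

variable (P : SiteChain)

/-! ### The generator on test functions -/

namespace UniformlyConfining

variable {P}

/-- For a uniformly confining chain, `∂_{q_i} H` is continuous. [folklore] -/
theorem continuous_partialQ_hamiltonian (hP : P.UniformlyConfining) (N : ℕ) (i : Fin N) :
    Continuous (partialQ i (P.hamiltonian N)) := by
  have hH : ContDiff ℝ 1 (P.hamiltonian N) := (hP.contDiff_hamiltonian N).of_le (by norm_num)
  have hd : Differentiable ℝ (P.hamiltonian N) := hH.differentiable one_ne_zero
  have : partialQ i (P.hamiltonian N) =
      fun x => fderiv ℝ (P.hamiltonian N) x ((Pi.single i 1, 0) : PhaseSpace N) := by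
    funext x; rw [partialQ_eq_lineDeriv, (hd x).lineDeriv_eq_fderiv]
  rw [this]
  exact (hH.continuous_fderiv one_ne_zero).clm_apply continuous_const

/-- For a uniformly confining chain and `f ∈ C²`, `L f` is continuous. [folklore] -/
theorem continuous_generator (hP : P.UniformlyConfining) (N : ℕ) (T_L T_R : ℝ) {f : PhaseSpace N → ℝ}
    (hf : ContDiff ℝ 2 f) : Continuous (P.generator N T_L T_R f) := by
  have h2 : (2 : WithTop ℕ∞) ≠ 0 := by norm_num
  have hq : ∀ i : Fin N, Continuous (partialQ i f) := fun i => continuous_partialQ hf h2 i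
  have hp : ∀ i : Fin N, Continuous (partialP i f) := fun i => continuous_partialP hf h2 i
  have hpp : ∀ i : Fin N, Continuous (partialP i (partialP i f)) := fun i =>
    continuous_partialP (contDiff_partialP hf (m := 1) (by norm_num) i) one_ne_zero i
  have hqH : ∀ i : Fin N, Continuous (partialQ i (P.hamiltonian N)) := fun i =>
    hP.continuous_partialQ_hamiltonian N i
  have hx2 : ∀ i : Fin N, Continuous fun x : PhaseSpace N => x.2 i := fun i =>
    (continuous_apply i).comp continuous_snd
  unfold SiteChain.generator
  refine Continuous.add (continuous_finsetSum _ fun i _ =>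
    ((hx2 i).mul (hq i)).sub ((hqH i).mul (hp i))) (continuous_const.mul
      (continuous_finsetSum _ fun i _ => Continuous.add ?_ ?_))
  · by_cases h : i.val = 0
    · simp only [h, if_true]
      exact (continuous_const.mul (hpp i)).sub ((hx2 i).mul (hp i))
    · simp only [h, if_false]
      exact continuous_const
  · by_cases h : i.val = N - 1
    · simp only [h, if_true]
      exact (continuous_const.mul (hpp i)).sub ((hx2 i).mul (hp i))
    · simp only [h, if_false]
      exact continuous_const

/-- For `f ∈ C²_c`, `L f` has compact support (every term carries a derivative of `f`); stated for a
uniformly confining chain. [folklore] -/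
theorem hasCompactSupport_generator (_hP : P.UniformlyConfining) (N : ℕ) (T_L T_R : ℝ)
    {f : PhaseSpace N → ℝ} (hf : ContDiff ℝ 2 f) (hfc : HasCompactSupport f) :
    HasCompactSupport (P.generator N T_L T_R f) := by
  have hd : Differentiable ℝ f := hf.differentiable (by norm_num)
  have hd1 : ∀ i : Fin N, Differentiable ℝ (partialP i f) := fun i =>
    (contDiff_partialP hf (m := 1) (by norm_num) i).differentiable one_ne_zero
  have hq : ∀ i : Fin N, HasCompactSupport (partialQ i f) := fun i =>
    hasCompactSupport_partialQ hd hfc i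
  have hp : ∀ i : Fin N, HasCompactSupport (partialP i f) := fun i =>
    hasCompactSupport_partialP hd hfc i
  have hpp : ∀ i : Fin N, HasCompactSupport (partialP i (partialP i f)) := fun i =>
    hasCompactSupport_partialP (hd1 i) (hp i) i
  simp only [hasCompactSupport_iff_eventuallyEq] at hq hp hpp ⊢
  have hq' : ∀ᶠ x in Filter.coclosedCompact (PhaseSpace N), ∀ i, partialQ i f x = 0 :=
    Filter.eventually_all.mpr fun i => (hq i).mono fun x hx => hx
  have hp' : ∀ᶠ x in Filter.coclosedCompact (PhaseSpace N), ∀ i, partialP i f x = 0 :=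
    Filter.eventually_all.mpr fun i => (hp i).mono fun x hx => hx
  have hpp' : ∀ᶠ x in Filter.coclosedCompact (PhaseSpace N),
      ∀ i, partialP i (partialP i f) x = 0 :=
    Filter.eventually_all.mpr fun i => (hpp i).mono fun x hx => hx
  filter_upwards [hq', hp', hpp'] with x hxq hxp hxpp
  simp [SiteChain.generator, hxq, hxp, hxpp]

/-- For a uniformly confining chain and `f ∈ C²_c`, `L f` is bounded. [folklore] -/
theorem exists_bound_generator (hP : P.UniformlyConfining) (N : ℕ) (T_L T_R : ℝ)
    {f : PhaseSpace N → ℝ} (hf : ContDiff ℝ 2 f) (hfc : HasCompactSupport f) :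
    ∃ C, ∀ x, ‖P.generator N T_L T_R f x‖ ≤ C :=
  (hP.continuous_generator N T_L T_R hf).bounded_above_of_compact_support
    (hP.hasCompactSupport_generator N T_L T_R hf hfc)

end UniformlyConfining

end SiteChain

/-! ### The drift inequality for a `MarkovSemigroupFor (P.generator N T_L T_R)` -/

namespace MarkovSemigroupFor

variable {P : SiteChain} {T_L T_R : ℝ} (S : MarkovSemigroupFor (P.generator N T_L T_R))

/-- **The truncated drift inequality** for a uniformly confining site chain (`N ≥ 1`, `T_L, T_R ≥ 0`),
a Markov semigroup `S` with Dynkin's identity for its generator (extended to `C²_c`), a proper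
`𝒱 ∈ C²`, `𝒱 ≥ 0` with `L𝒱 ≤ C - W` (`W ≥ 0` continuous, `C ≥ 0`) and every `R > 0`:
`∫ Rφ(𝒱/R) dP_t(z,·) + ∫₀ᵗ ∫ χ(𝒱/R) W dP_s(z,·) ds ≤ 𝒱(z) + C t`.
[cite: HairerMattingly2009, Prop 5.1 (proof)] -/
theorem siteChain_lintegral_truncLyapunov_add_le (hP : P.UniformlyConfining) (hN : 0 < N)
    (hTL : 0 ≤ T_L) (hTR : 0 ≤ T_R)
    (hdyn : ∀ f : PhaseSpace N → ℝ, ContDiff ℝ 2 f → HasCompactSupport f →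
      ∀ (t : ℝ≥0) (z : PhaseSpace N), S.act t f z - f z =
        ∫ s in (0 : ℝ)..(t : ℝ), S.act s.toNNReal (P.generator N T_L T_R f) z)
    {𝒱 W : PhaseSpace N → ℝ} (h𝒱 : ContDiff ℝ 2 𝒱) (h𝒱0 : ∀ x, 0 ≤ 𝒱 x)
    (h𝒱c : ∀ R : ℝ, IsCompact {x | 𝒱 x ≤ R}) (hW : Continuous W) (hW0 : ∀ x, 0 ≤ W x)
    {C : ℝ} (hC : 0 ≤ C) (hLV : ∀ x, P.generator N T_L T_R 𝒱 x ≤ C - W x)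
    {R : ℝ} (hR0 : 0 < R) (t : ℝ≥0) (z : PhaseSpace N) :
    ∫⁻ y, ENNReal.ofReal (R * linCutoff (𝒱 y / R)) ∂(S.kernel t z) +
        ∫⁻ s in Ioc (0 : ℝ) t, ∫⁻ y, ENNReal.ofReal (smoothCutoff (𝒱 y / R) * W y)
          ∂(S.kernel s.toNNReal z) ≤
      ENNReal.ofReal (𝒱 z + C * t) := by
  have hL : 0 ≤ P.γ * T_L := mul_nonneg hP.γ_nonneg hTL
  have hR : 0 ≤ P.γ * T_R := mul_nonneg hP.γ_nonneg hTR
  -- the truncated Lyapunov function `g`, its compactly supported shift `u`, the truncated `W`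
  set g : PhaseSpace N → ℝ := fun y => R * linCutoff (𝒱 y / R) with hgdef
  set c : ℝ := R * linCutoff 2 with hcdef
  set u : PhaseSpace N → ℝ := fun y => g y - c with hudef
  set w : PhaseSpace N → ℝ := fun y => smoothCutoff (𝒱 y / R) * W y with hwdef
  have hRne : R ≠ 0 := hR0.ne'
  have h𝒱cont : Continuous 𝒱 := h𝒱.continuous
  have hg2 : ContDiff ℝ 2 g :=
    contDiff_const.mul (contDiff_two_linCutoff.comp (h𝒱.div_const R))
  have hu2 : ContDiff ℝ 2 u := hg2.sub contDiff_const
  have hu_supp : HasCompactSupport u := by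
    refine HasCompactSupport.intro (h𝒱c (2 * R)) fun x hx => ?_
    simp only [mem_setOf_eq, not_le] at hx
    have h2 : 2 ≤ 𝒱 x / R := by rw [le_div_iff₀ hR0]; linarith
    show R * linCutoff (𝒱 x / R) - R * linCutoff 2 = 0
    rw [linCutoff_of_two_le h2, sub_self]
  have hvR : ∀ y, 0 ≤ 𝒱 y / R := fun y => div_nonneg (h𝒱0 y) hR0.le
  have hg_nonneg : ∀ y, 0 ≤ g y := fun y => mul_nonneg hR0.le (linCutoff_nonneg (hvR y))
  have hg_le : ∀ y, g y ≤ 2 * R := fun y => by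
    have := mul_le_mul_of_nonneg_left (linCutoff_le_two (hvR y)) hR0.le
    show R * linCutoff (𝒱 y / R) ≤ 2 * R
    linarith
  have hg_leV : ∀ y, g y ≤ 𝒱 y := fun y => by
    have := mul_le_mul_of_nonneg_left (linCutoff_le_self (hvR y)) hR0.le
    have h1 : R * (𝒱 y / R) = 𝒱 y := by field_simp
    show R * linCutoff (𝒱 y / R) ≤ 𝒱 y
    linarith
  have hg_norm : ∀ y, ‖g y‖ ≤ 2 * R := fun y => by
    rw [Real.norm_of_nonneg (hg_nonneg y)]; exact hg_le y
  have hg_cont : Continuous g := hg2.continuous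
  have hχ0 : ∀ y, 0 ≤ smoothCutoff (𝒱 y / R) := fun y => smoothCutoff_nonneg _
  have hχ1 : ∀ y, smoothCutoff (𝒱 y / R) ≤ 1 := fun y => smoothCutoff_le_one _
  have hw_cont : Continuous w := (continuous_smoothCutoff.comp (h𝒱cont.div_const R)).mul hW
  have hw0 : ∀ y, 0 ≤ w y := fun y => mul_nonneg (hχ0 y) (hW0 y)
  obtain ⟨M, hM⟩ : ∃ M, ∀ y, ‖w y‖ ≤ M := by
    obtain ⟨M, hM⟩ := (h𝒱c (2 * R)).exists_bound_of_continuousOn hW.continuousOn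
    refine ⟨max M 0, fun y => ?_⟩
    rw [Real.norm_of_nonneg (hw0 y)]
    by_cases hy : 𝒱 y ≤ 2 * R
    · have h1 : ‖W y‖ ≤ M := hM y hy
      rw [Real.norm_of_nonneg (hW0 y)] at h1
      calc w y = smoothCutoff (𝒱 y / R) * W y := rfl
        _ ≤ 1 * W y := mul_le_mul_of_nonneg_right (hχ1 y) (hW0 y)
        _ ≤ max M 0 := by rw [one_mul]; exact h1.trans (le_max_left _ _)
    · have h2 : 2 ≤ 𝒱 y / R := by rw [le_div_iff₀ hR0]; linarith
      calc w y = smoothCutoff (𝒱 y / R) * W y := rfl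
        _ = 0 := by rw [smoothCutoff_of_two_le h2, zero_mul]
        _ ≤ max M 0 := le_max_right _ _
  -- `L g = L u` is bounded and continuous, and `L g ≤ C - w`
  have hLu : P.generator N T_L T_R u = P.generator N T_L T_R g := by
    have hQ : ∀ i : Fin N, partialQ i (fun y => g y - c) = partialQ i g := fun i => by
      funext x; unfold partialQ; exact deriv_sub_const _
    have hPp : ∀ (i : Fin N) (g' : PhaseSpace N → ℝ),
        partialP i (fun y => g' y - c) = partialP i g' := fun i g' => by
      funext x; unfold partialP; exact deriv_sub_const _
    funext x
    simp only [SiteChain.generator, hudef, hQ, hPp]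
  have hLg_cont : Continuous (P.generator N T_L T_R g) := hP.continuous_generator N T_L T_R hg2
  obtain ⟨CL, hCL⟩ : ∃ CL, ∀ x, ‖P.generator N T_L T_R g x‖ ≤ CL := by
    obtain ⟨CL, hCL⟩ := hP.exists_bound_generator N T_L T_R hu2 hu_supp
    exact ⟨CL, fun x => by rw [← hLu]; exact hCL x⟩
  have hLg_le : ∀ x, P.generator N T_L T_R g x ≤ C - w x := by
    intro x
    have hF : ∀ v, HasDerivAt (fun v => R * linCutoff (v / R)) (smoothCutoff (v / R)) v :=
      hasDerivAt_scaled_linCutoff hRne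
    have hF' : ∀ v, HasDerivAt (fun v => smoothCutoff (v / R)) (deriv smoothCutoff (v / R) / R) v :=
      hasDerivAt_scaled_smoothCutoff R
    have hF'' : deriv smoothCutoff (𝒱 x / R) / R ≤ 0 :=
      div_nonpos_of_nonpos_of_nonneg (deriv_smoothCutoff_nonpos _) hR0.le
    have h1 : P.generator N T_L T_R g x = sdeGenerator (P.langevinDrift N) (P.noiseVecL N T_L) (P.noiseVecR N T_R) g x := by
      rw [P.sdeGenerator_langevinDrift_eq_generator hN hL hR hg2]
    have h2 : sdeGenerator (P.langevinDrift N) (P.noiseVecL N T_L) (P.noiseVecR N T_R) 𝒱 x = P.generator N T_L T_R 𝒱 x := by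
      rw [P.sdeGenerator_langevinDrift_eq_generator hN hL hR h𝒱]
    have h3 := sdeGenerator_comp_le (P.langevinDrift N) (P.noiseVecL N T_L) (P.noiseVecR N T_R) hF hF'
      h𝒱 (y := x) hF''
    rw [h2] at h3
    rw [h1]
    refine h3.trans ?_
    have h4 : smoothCutoff (𝒱 x / R) * P.generator N T_L T_R 𝒱 x ≤ smoothCutoff (𝒱 x / R) * (C - W x) :=
      mul_le_mul_of_nonneg_left (hLV x) (hχ0 x)
    have h5 : smoothCutoff (𝒱 x / R) * C ≤ C := by
      have := mul_le_mul_of_nonneg_right (hχ1 x) hC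
      linarith
    show smoothCutoff (𝒱 x / R) * P.generator N T_L T_R 𝒱 x ≤ C - smoothCutoff (𝒱 x / R) * W x
    nlinarith
  -- the orbit maps `ψ(s) = P_s (L g)(z)`, `ω(s) = P_s w (z)`
  set ψ : ℝ → ℝ := fun s => S.act s.toNNReal (P.generator N T_L T_R g) z with hψdef
  set ω' : ℝ → ℝ := fun s => S.act s.toNNReal w z with hωdef
  have hψ_meas : StronglyMeasurable ψ :=
    (S.stronglyMeasurable_uncurry_act hLg_cont.stronglyMeasurable).comp_measurable
      (measurable_const.prodMk measurable_id)
  have hω_meas : StronglyMeasurable ω' :=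
    (S.stronglyMeasurable_uncurry_act hw_cont.stronglyMeasurable).comp_measurable
      (measurable_const.prodMk measurable_id)
  have hψ_bound : ∀ s, ‖ψ s‖ ≤ CL := fun s => S.norm_act_le _ hCL z
  have hω_bound : ∀ s, ‖ω' s‖ ≤ M := fun s => S.norm_act_le _ hM z
  have hω_nonneg : ∀ s, 0 ≤ ω' s := fun s => integral_nonneg hw0
  have hψ_int : ∀ a b, IntervalIntegrable ψ volume a b := intervalIntegrable_of_norm_le hψ_meas hψ_bound
  have hω_int : ∀ a b, IntervalIntegrable ω' volume a b := intervalIntegrable_of_norm_le hω_meas hω_bound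
  have hψ_le : ∀ s, ψ s ≤ C - ω' s := fun s => by
    have hint_g : Integrable (P.generator N T_L T_R g) (S.kernel s.toNNReal z) :=
      S.integrable_kernel_of_norm_le _ z hLg_cont hCL
    have hint_w : Integrable w (S.kernel s.toNNReal z) := S.integrable_kernel_of_norm_le _ z hw_cont hM
    have hC' : ∫ y, (C - w y) ∂(S.kernel s.toNNReal z) = C - ω' s := by
      rw [integral_sub (integrable_const C) hint_w]
      have : ∫ _ : PhaseSpace N, C ∂(S.kernel s.toNNReal z) = C := by simp
      rw [this]
      rfl
    calc ψ s = ∫ y, P.generator N T_L T_R g y ∂(S.kernel s.toNNReal z) := rfl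
      _ ≤ ∫ y, (C - w y) ∂(S.kernel s.toNNReal z) :=
          integral_mono hint_g ((integrable_const C).sub hint_w) hLg_le
      _ = C - ω' s := hC'
  -- Dynkin's identity for `u` at time `t`
  have ht0 : (0 : ℝ) ≤ t := t.coe_nonneg
  have hdyn_g : S.act t g z - g z = ∫ s in (0 : ℝ)..(t : ℝ), ψ s := by
    have h := hdyn u hu2 hu_supp t z
    rw [hLu] at h
    have hint : S.act t u z = S.act t g z - c := by
      show ∫ y, (g y - c) ∂(S.kernel t z) = (∫ y, g y ∂(S.kernel t z)) - c
      rw [integral_sub (S.integrable_kernel_of_norm_le _ z hg_cont hg_norm) (integrable_const c)]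
      simp
    rw [hint] at h
    have hu0 : u z = g z - c := rfl
    rw [hu0] at h
    linarith
  -- the real-valued inequality
  have hreal : S.act t g z + ∫ s in (0 : ℝ)..(t : ℝ), ω' s ≤ 𝒱 z + C * t := by
    have h1 : ∫ s in (0 : ℝ)..(t : ℝ), ψ s ≤ ∫ s in (0 : ℝ)..(t : ℝ), (C - ω' s) :=
      intervalIntegral.integral_mono_on ht0 (hψ_int 0 t)
        ((intervalIntegrable_const).sub (hω_int 0 t)) fun s _ => hψ_le s
    have h2 : ∫ s in (0 : ℝ)..(t : ℝ), (C - ω' s) = C * t - ∫ s in (0 : ℝ)..(t : ℝ), ω' s := by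
      rw [intervalIntegral.integral_sub intervalIntegrable_const (hω_int 0 t),
        intervalIntegral.integral_const, smul_eq_mul, sub_zero, mul_comm]
    have h3 := hg_leV z
    linarith
  -- conversion to Lebesgue integrals
  have hA : ∫⁻ y, ENNReal.ofReal (g y) ∂(S.kernel t z) = ENNReal.ofReal (S.act t g z) := by
    rw [act_apply, ofReal_integral_eq_lintegral_ofReal
      (S.integrable_kernel_of_norm_le _ z hg_cont hg_norm) (Eventually.of_forall hg_nonneg)]
  have hB : ∫⁻ s in Ioc (0 : ℝ) t, ∫⁻ y, ENNReal.ofReal (w y) ∂(S.kernel s.toNNReal z) =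
      ENNReal.ofReal (∫ s in (0 : ℝ)..(t : ℝ), ω' s) := by
    have h1 : ∀ s, ∫⁻ y, ENNReal.ofReal (w y) ∂(S.kernel s.toNNReal z) = ENNReal.ofReal (ω' s) :=
      fun s => by
        show _ = ENNReal.ofReal (∫ y, w y ∂(S.kernel s.toNNReal z))
        rw [ofReal_integral_eq_lintegral_ofReal
          (S.integrable_kernel_of_norm_le _ z hw_cont hM) (Eventually.of_forall hw0)]
    simp_rw [h1]
    have hint : Integrable ω' (volume.restrict (Ioc (0 : ℝ) t)) := (hω_int 0 t).1
    rw [intervalIntegral.integral_of_le ht0,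
      ofReal_integral_eq_lintegral_ofReal hint (Eventually.of_forall hω_nonneg)]
  have hint_nonneg : 0 ≤ ∫ s in (0 : ℝ)..(t : ℝ), ω' s :=
    intervalIntegral.integral_nonneg ht0 fun s _ => hω_nonneg s
  have hact_nonneg : 0 ≤ S.act t g z := integral_nonneg hg_nonneg
  rw [hA, hB, ← ENNReal.ofReal_add hact_nonneg hint_nonneg]
  exact ENNReal.ofReal_le_ofReal hreal

end MarkovSemigroupFor

end Literature.MathematicalPhysics.KineticTheory.HeatConduction
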